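import Summits.BirchSwinnertonDyer.BirchSwinnertonDyer.Theorems.ManinLocalTwoThreeEulerRemaindersThirtyTwo
import HarnessLib

/-!
# The Euler functions at level 20: `E₁`, `E₂`, `E₅` to order `q⁶`; `x`, `y`, `φ₂₀` as `q`-monomials times
# Euler functions; the derivatives of `x`, `y`

Cell bsd-f2-manin, route `ManinLocalTwoThree`; the level-`20` twin of `ManinLocalTwoThreeEulerRemaindersThirtyTwo`
(toolkit for the three limits (T1)₂₀–(T3)₂₀ of `LevelTwenty.abs_maninConstant_eq_one_twenty_of_tendsto`).
With `E_δ(τ) = ∏_{n ≥ 1} (1 − q^{δn})` (`eulerFn δ`), `q = e^{2πiτ}`, in the remainder language of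
`ManinLocalTwoThreeQRemainderCalculus`:

* `E₁ = 1 − q − q² + q⁵ + o(q⁶)` (Euler's pentagonal numbers), `E₂ = 1 − q² − q⁴ + o(q⁶)`,
  `E₅ = 1 − q⁵ + o(q⁶)`, and `(2πi)⁻¹E₁′ = −q − 2q² + 5q⁵ + o(q⁶)`, `(2πi)⁻¹E₂′ = −2q² − 4q⁴ + o(q⁶)`,
  `(2πi)⁻¹E₅′ = −5q⁵ + o(q⁶)`; a monotonicity lemma `tendsto_mono` lowering the order `m`;
* `x = η(4τ)η(10τ)⁵/(η(2τ)η(20τ)⁵) = E₄E₁₀⁵/(q²E₂E₂₀⁵)`, `y = η(4τ)η(5τ)⁵/(η(τ)η(20τ)⁵) = E₄E₅⁵/(q³E₁E₂₀⁵)`,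
  `φ₂₀ = η(2τ)²η(10τ)² = qE₂²E₁₀²` (`x20_eq`, `y20_eq`, `etaProductTwenty_eq`);
* the logarithmic derivatives `deriv_x20`, `deriv_y20`.
-/

set_option autoImplicit false
set_option linter.dupNamespace false

noncomputable section

open Complex Filter Topology Set Asymptotics Polynomial
open UpperHalfPlane hiding I
open scoped Real Topology Manifold MatrixGroups
open Literature.NumberTheory.EllipticCurves Literature.NumberTheory.EllipticCurves.ModularForms

namespace Summit.BirchSwinnertonDyer.BirchSwinnertonDyer.Theorems.ManinLocalTwoThree.EulerRemaindersTwenty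

open QRemainder EulerRemainders
open LigozatIdentities (hasDerivAt_eulerFn_comp)

/-! ## 0. Lowering the order of a remainder -/

/-- `f = P(q) + o(q^m)` implies `f = P(q) + o(q^{m'})` for `m' ≤ m`. [folklore] -/
theorem tendsto_mono {f : ℍ → ℂ} {P : ℂ[X]} {m m' : ℕ} (hm : m' ≤ m)
    (h : Tendsto (fun τ : ℍ ↦ (f τ - P.eval (Function.Periodic.qParam 1 (τ : ℂ)))
      / Function.Periodic.qParam 1 (τ : ℂ) ^ m) atImInfty (𝓝 0)) :
    Tendsto (fun τ : ℍ ↦ (f τ - P.eval (Function.Periodic.qParam 1 (τ : ℂ)))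
      / Function.Periodic.qParam 1 (τ : ℂ) ^ m') atImInfty (𝓝 0) := by
  have h2 := h.mul ((continuous_pow (m - m')).tendsto 0 |>.comp tendsto_qParam)
  rw [zero_mul] at h2
  refine h2.congr fun τ ↦ ?_
  have hq := qParam_ne_zero τ
  rw [Function.comp_apply, div_mul_eq_mul_div, div_eq_div_iff (pow_ne_zero m hq) (pow_ne_zero m' hq),
    mul_assoc, ← pow_add, Nat.sub_add_cancel hm]

/-! ## 1. `E₁`, `E₂`, `E₅` and their derivatives to order `q⁶` -/

/-- `∏_{n ≥ 1} (1 − Xⁿ) = 1 − X − X² + X⁵ + ⋯` (Euler): the coefficients `0, …, 6`. [folklore] -/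
theorem coeff_formalEulerPow_one_le_six (n : ℕ) (hn : n ≤ 6) :
    PowerSeries.coeff n (formalEulerPow 1)
      = if n = 0 then 1 else if n = 1 then -1 else if n = 2 then -1 else if n = 5 then 1 else 0 := by
  have h6 : eulerTrunc 1 6 = 1 - PowerSeries.X - PowerSeries.X ^ 2 + PowerSeries.X ^ 5
      + 2 * PowerSeries.X ^ 7 - PowerSeries.X ^ 9 - PowerSeries.X ^ 10 - PowerSeries.X ^ 11
      - PowerSeries.X ^ 12 + 2 * PowerSeries.X ^ 14 + PowerSeries.X ^ 16 - PowerSeries.X ^ 19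
      - PowerSeries.X ^ 20 + PowerSeries.X ^ 21 := by
    rw [eulerTrunc]
    simp only [Finset.prod_range_succ, Finset.prod_range_zero]
    ring
  rw [coeff_formalEulerPow hn, h6]
  interval_cases n <;> simp [PowerSeries.coeff_X_pow, PowerSeries.coeff_X, PowerSeries.coeff_mul_X_pow']

/-- The first seven `q`-coefficients of `E₁`: `1, −1, −1, 0, 0, 1, 0`. [folklore] -/
theorem coeff_formalEulerScaled_one (n : ℕ) (hn : n ≤ 6) :
    PowerSeries.coeff n (formalEulerScaled 1)
      = if n = 0 then 1 else if n = 1 then -1 else if n = 2 then -1 else if n = 5 then 1 else 0 := by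
  rw [coeff_formalEulerScaled, if_pos (one_dvd n), Nat.div_one, coeff_formalEulerPow_one_le_six n hn]

/-- The first seven `q`-coefficients of `E₂`: `1, 0, −1, 0, −1, 0, 0`. [folklore] -/
theorem coeff_formalEulerScaled_two (n : ℕ) (hn : n ≤ 6) :
    PowerSeries.coeff n (formalEulerScaled 2) = if n = 0 then 1 else if n = 2 then -1 else if n = 4 then -1 else 0 := by
  have h := coeff_formalEulerPow_one_le_six
  interval_cases n <;> simp +decide [coeff_formalEulerScaled, h]

/-- The first seven `q`-coefficients of `E₅`: `1, 0, 0, 0, 0, −1, 0`. [folklore] -/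
theorem coeff_formalEulerScaled_five (n : ℕ) (hn : n ≤ 6) :
    PowerSeries.coeff n (formalEulerScaled 5) = if n = 0 then 1 else if n = 5 then -1 else 0 := by
  have h := coeff_formalEulerPow_one_le_six
  interval_cases n <;> simp +decide [coeff_formalEulerScaled, h]

/-- **`E₁ = 1 − q − q² + q⁵ + o(q⁶)`.** [folklore] -/
theorem tendsto_eulerFn_one :
    Tendsto (fun τ : ℍ ↦ (eulerFn 1 τ - (1 - X - X ^ 2 + X ^ 5 : ℂ[X]).eval (Function.Periodic.qParam 1 (τ : ℂ)))
      / Function.Periodic.qParam 1 (τ : ℂ) ^ 6) atImInfty (𝓝 0) := by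
  refine congr_poly ?_ (tendsto_of_hasSum (periodic_eulerFn 1) (mdifferentiable_eulerFn 1)
    (isBoundedAtImInfty_eulerFn (by norm_num)) (hasSum_eulerFn (by norm_num)) 6)
  have h := coeff_formalEulerScaled_one
  simp only [Finset.sum_range_succ, Finset.sum_range_zero, h 0 (by norm_num), h 1 (by norm_num),
    h 2 (by norm_num), h 3 (by norm_num), h 4 (by norm_num), h 5 (by norm_num), h 6 (by norm_num)]
  norm_num
  ring

/-- **`E₂ = 1 − q² − q⁴ + o(q⁶)`.** [folklore] -/
theorem tendsto_eulerFn_two :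
    Tendsto (fun τ : ℍ ↦ (eulerFn 2 τ - (1 - X ^ 2 - X ^ 4 : ℂ[X]).eval (Function.Periodic.qParam 1 (τ : ℂ)))
      / Function.Periodic.qParam 1 (τ : ℂ) ^ 6) atImInfty (𝓝 0) := by
  refine congr_poly ?_ (tendsto_of_hasSum (periodic_eulerFn 2) (mdifferentiable_eulerFn 2)
    (isBoundedAtImInfty_eulerFn (by norm_num)) (hasSum_eulerFn (by norm_num)) 6)
  have h := coeff_formalEulerScaled_two
  simp only [Finset.sum_range_succ, Finset.sum_range_zero, h 0 (by norm_num), h 1 (by norm_num),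
    h 2 (by norm_num), h 3 (by norm_num), h 4 (by norm_num), h 5 (by norm_num), h 6 (by norm_num)]
  norm_num
  ring

/-- **`E₅ = 1 − q⁵ + o(q⁶)`.** [folklore] -/
theorem tendsto_eulerFn_five :
    Tendsto (fun τ : ℍ ↦ (eulerFn 5 τ - (1 - X ^ 5 : ℂ[X]).eval (Function.Periodic.qParam 1 (τ : ℂ)))
      / Function.Periodic.qParam 1 (τ : ℂ) ^ 6) atImInfty (𝓝 0) := by
  refine congr_poly ?_ (tendsto_of_hasSum (periodic_eulerFn 5) (mdifferentiable_eulerFn 5)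
    (isBoundedAtImInfty_eulerFn (by norm_num)) (hasSum_eulerFn (by norm_num)) 6)
  have h := coeff_formalEulerScaled_five
  simp only [Finset.sum_range_succ, Finset.sum_range_zero, h 0 (by norm_num), h 1 (by norm_num),
    h 2 (by norm_num), h 3 (by norm_num), h 4 (by norm_num), h 5 (by norm_num), h 6 (by norm_num)]
  norm_num
  ring

/-- **`E₁′ = 2πi(−q − 2q² + 5q⁵) + o(q⁶)`.** [folklore] -/
theorem tendsto_deriv_eulerFn_one :
    Tendsto (fun τ : ℍ ↦ (deriv (eulerFn 1 ∘ ofComplex) τ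
      - (C (2 * π * I) * (-X - 2 * X ^ 2 + 5 * X ^ 5) : ℂ[X]).eval (Function.Periodic.qParam 1 (τ : ℂ)))
      / Function.Periodic.qParam 1 (τ : ℂ) ^ 6) atImInfty (𝓝 0) := by
  refine congr_poly ?_ (congr_fun (fun τ ↦ deriv_eulerFn_sub_one 1 τ)
    (tendsto_deriv_of_isCuspFunction (isCuspFunction_eulerFn_sub_one (by norm_num : 0 < 1)) 6))
  have h := coeff_formalEulerScaled_one
  have hc : ∀ n : ℕ, n ≠ 0 → n ≤ 6 → (qExpansion 1 (eulerFn 1 - 1)).coeff n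
      = (((if n = 0 then 1 else if n = 1 then -1 else if n = 2 then -1 else if n = 5 then 1 else 0 : ℤ)) : ℂ) :=
    fun n hn hn6 ↦ by rw [qExpansion_eulerFn_sub_one_coeff_of_ne_zero (by norm_num) hn, h n hn6]
  simp only [Finset.sum_range_succ, Finset.sum_range_zero, hc 1 one_ne_zero (by norm_num),
    hc 2 (by norm_num) (by norm_num), hc 3 (by norm_num) (by norm_num), hc 4 (by norm_num) (by norm_num),
    hc 5 (by norm_num) (by norm_num), hc 6 (by norm_num) (by norm_num)]
  norm_num
  simp only [map_ofNat]
  ring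

/-- **`E₂′ = 2πi(−2q² − 4q⁴) + o(q⁶)`.** [folklore] -/
theorem tendsto_deriv_eulerFn_two :
    Tendsto (fun τ : ℍ ↦ (deriv (eulerFn 2 ∘ ofComplex) τ
      - (C (2 * π * I) * (-2 * X ^ 2 - 4 * X ^ 4) : ℂ[X]).eval (Function.Periodic.qParam 1 (τ : ℂ)))
      / Function.Periodic.qParam 1 (τ : ℂ) ^ 6) atImInfty (𝓝 0) := by
  refine congr_poly ?_ (congr_fun (fun τ ↦ deriv_eulerFn_sub_one 2 τ)
    (tendsto_deriv_of_isCuspFunction (isCuspFunction_eulerFn_sub_one (by norm_num : 0 < 2)) 6))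
  have h := coeff_formalEulerScaled_two
  have hc : ∀ n : ℕ, n ≠ 0 → n ≤ 6 → (qExpansion 1 (eulerFn 2 - 1)).coeff n
      = (((if n = 0 then 1 else if n = 2 then -1 else if n = 4 then -1 else 0 : ℤ)) : ℂ) :=
    fun n hn hn6 ↦ by rw [qExpansion_eulerFn_sub_one_coeff_of_ne_zero (by norm_num) hn, h n hn6]
  simp only [Finset.sum_range_succ, Finset.sum_range_zero, hc 1 one_ne_zero (by norm_num),
    hc 2 (by norm_num) (by norm_num), hc 3 (by norm_num) (by norm_num), hc 4 (by norm_num) (by norm_num),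
    hc 5 (by norm_num) (by norm_num), hc 6 (by norm_num) (by norm_num)]
  norm_num
  simp only [map_ofNat]
  ring

/-- **`E₅′ = 2πi(−5q⁵) + o(q⁶)`.** [folklore] -/
theorem tendsto_deriv_eulerFn_five :
    Tendsto (fun τ : ℍ ↦ (deriv (eulerFn 5 ∘ ofComplex) τ
      - (C (2 * π * I) * (-5 * X ^ 5) : ℂ[X]).eval (Function.Periodic.qParam 1 (τ : ℂ)))
      / Function.Periodic.qParam 1 (τ : ℂ) ^ 6) atImInfty (𝓝 0) := by
  refine congr_poly ?_ (congr_fun (fun τ ↦ deriv_eulerFn_sub_one 5 τ)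
    (tendsto_deriv_of_isCuspFunction (isCuspFunction_eulerFn_sub_one (by norm_num : 0 < 5)) 6))
  have h := coeff_formalEulerScaled_five
  have hc : ∀ n : ℕ, n ≠ 0 → n ≤ 6 → (qExpansion 1 (eulerFn 5 - 1)).coeff n
      = (((if n = 0 then 1 else if n = 5 then -1 else 0 : ℤ)) : ℂ) :=
    fun n hn hn6 ↦ by rw [qExpansion_eulerFn_sub_one_coeff_of_ne_zero (by norm_num) hn, h n hn6]
  simp only [Finset.sum_range_succ, Finset.sum_range_zero, hc 1 one_ne_zero (by norm_num),
    hc 2 (by norm_num) (by norm_num), hc 3 (by norm_num) (by norm_num), hc 4 (by norm_num) (by norm_num),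
    hc 5 (by norm_num) (by norm_num), hc 6 (by norm_num) (by norm_num)]
  norm_num
  simp only [map_ofNat]
  ring

/-! ## 2. `x`, `y`, `φ₂₀` in terms of `q` and the Euler functions -/

/-- **`x = η(4τ)η(10τ)⁵/(η(2τ)η(20τ)⁵) = E₄E₁₀⁵/(q² E₂ E₂₀⁵)`.** [folklore] -/
theorem x20_eq (τ : ℍ) :
    etaQuotient 20 (expFn [(2, -1), (4, 1), (10, 5), (20, -5)]) τ
      = eulerFn 4 τ * eulerFn 10 τ ^ 5
        / (Function.Periodic.qParam 1 (τ : ℂ) ^ 2 * eulerFn 2 τ * eulerFn 20 τ ^ 5) := by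
  have hE2 := eulerFn_ne_zero (by norm_num : 0 < 2) τ
  have hE20 := eulerFn_ne_zero (by norm_num : 0 < 20) τ
  have hq := qParam_ne_zero τ
  rw [etaQuotient_eq_cexp_mul_prod, show Nat.divisors 20 = {1, 2, 4, 5, 10, 20} by decide]
  have hsum : (∑ δ ∈ ({1, 2, 4, 5, 10, 20} : Finset ℕ),
      (δ : ℤ) * expFn [(2, -1), (4, 1), (10, 5), (20, -5)] δ) = (-(24 * 2 : ℕ) : ℤ) := by decide
  rw [hsum, cexp_neg_eq_inv_qParam_pow]
  rw [Finset.prod_insert (by decide), Finset.prod_insert (by decide), Finset.prod_insert (by decide),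
    Finset.prod_insert (by decide), Finset.prod_insert (by decide), Finset.prod_singleton]
  rw [show expFn [(2, -1), (4, 1), (10, 5), (20, -5)] 1 = 0 by decide,
    show expFn [(2, -1), (4, 1), (10, 5), (20, -5)] 2 = -1 by decide,
    show expFn [(2, -1), (4, 1), (10, 5), (20, -5)] 4 = 1 by decide,
    show expFn [(2, -1), (4, 1), (10, 5), (20, -5)] 5 = 0 by decide,
    show expFn [(2, -1), (4, 1), (10, 5), (20, -5)] 10 = 5 by decide,
    show expFn [(2, -1), (4, 1), (10, 5), (20, -5)] 20 = -5 by decide]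
  simp only [zpow_neg, zpow_ofNat]
  field_simp

/-- **`y = η(4τ)η(5τ)⁵/(η(τ)η(20τ)⁵) = E₄E₅⁵/(q³ E₁ E₂₀⁵)`.** [folklore] -/
theorem y20_eq (τ : ℍ) :
    etaQuotient 20 (expFn [(1, -1), (4, 1), (5, 5), (20, -5)]) τ
      = eulerFn 4 τ * eulerFn 5 τ ^ 5
        / (Function.Periodic.qParam 1 (τ : ℂ) ^ 3 * eulerFn 1 τ * eulerFn 20 τ ^ 5) := by
  have hE1 := eulerFn_ne_zero (by norm_num : 0 < 1) τ
  have hE20 := eulerFn_ne_zero (by norm_num : 0 < 20) τ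
  have hq := qParam_ne_zero τ
  rw [etaQuotient_eq_cexp_mul_prod, show Nat.divisors 20 = {1, 2, 4, 5, 10, 20} by decide]
  have hsum : (∑ δ ∈ ({1, 2, 4, 5, 10, 20} : Finset ℕ),
      (δ : ℤ) * expFn [(1, -1), (4, 1), (5, 5), (20, -5)] δ) = (-(24 * 3 : ℕ) : ℤ) := by decide
  rw [hsum, cexp_neg_eq_inv_qParam_pow]
  rw [Finset.prod_insert (by decide), Finset.prod_insert (by decide), Finset.prod_insert (by decide),
    Finset.prod_insert (by decide), Finset.prod_insert (by decide), Finset.prod_singleton]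
  rw [show expFn [(1, -1), (4, 1), (5, 5), (20, -5)] 1 = -1 by decide,
    show expFn [(1, -1), (4, 1), (5, 5), (20, -5)] 2 = 0 by decide,
    show expFn [(1, -1), (4, 1), (5, 5), (20, -5)] 4 = 1 by decide,
    show expFn [(1, -1), (4, 1), (5, 5), (20, -5)] 5 = 5 by decide,
    show expFn [(1, -1), (4, 1), (5, 5), (20, -5)] 10 = 0 by decide,
    show expFn [(1, -1), (4, 1), (5, 5), (20, -5)] 20 = -5 by decide]
  simp only [zpow_neg, zpow_ofNat]
  field_simp

/-- **`φ₂₀ = η(2τ)²η(10τ)² = q E₂² E₁₀²`.** [folklore] -/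
theorem etaProductTwenty_eq (τ : ℍ) :
    cuspFormEtaProductTwenty τ
      = Function.Periodic.qParam 1 (τ : ℂ) * eulerFn 2 τ ^ 2 * eulerFn 10 τ ^ 2 := by
  rw [show (cuspFormEtaProductTwenty τ : ℂ) = etaProductTwenty τ from rfl, etaProductTwenty_apply]
  have h2 := eta_natMul_eq_qParam_mul_eulerFn 2 τ
  have h10 := eta_natMul_eq_qParam_mul_eulerFn 10 τ
  push_cast at h2 h10
  rw [h2, h10]
  have hq : Function.Periodic.qParam 24 (2 * (τ : ℂ)) ^ 2 * Function.Periodic.qParam 24 (10 * (τ : ℂ)) ^ 2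
      = Function.Periodic.qParam 1 (τ : ℂ) := by
    simp only [Function.Periodic.qParam, ← Complex.exp_nat_mul, ← Complex.exp_add]
    congr 1
    push_cast
    ring
  rw [← hq]
  ring

/-! ## 3. The derivatives of `x` and `y` -/

/-- **`x′ = x · (E₄′/E₄ + 5E₁₀′/E₁₀ − 2·2πi − E₂′/E₂ − 5E₂₀′/E₂₀)`.** [folklore] -/
theorem deriv_x20 (τ : ℍ) :
    deriv (etaQuotient 20 (expFn [(2, -1), (4, 1), (10, 5), (20, -5)]) ∘ ofComplex) τ
      = eulerFn 4 τ * eulerFn 10 τ ^ 5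
          / (Function.Periodic.qParam 1 (τ : ℂ) ^ 2 * eulerFn 2 τ * eulerFn 20 τ ^ 5)
        * (deriv (eulerFn 4 ∘ ofComplex) τ / eulerFn 4 τ
          + 5 * deriv (eulerFn 10 ∘ ofComplex) τ / eulerFn 10 τ - 2 * (2 * π * I)
          - deriv (eulerFn 2 ∘ ofComplex) τ / eulerFn 2 τ
          - 5 * deriv (eulerFn 20 ∘ ofComplex) τ / eulerFn 20 τ) := by
  have hE2 := eulerFn_ne_zero (by norm_num : 0 < 2) τ
  have hE4 := eulerFn_ne_zero (by norm_num : 0 < 4) τ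
  have hE10 := eulerFn_ne_zero (by norm_num : 0 < 10) τ
  have hE20 := eulerFn_ne_zero (by norm_num : 0 < 20) τ
  have hq := qParam_ne_zero τ
  have hfun : (etaQuotient 20 (expFn [(2, -1), (4, 1), (10, 5), (20, -5)]) ∘ ofComplex) =ᶠ[𝓝 (τ : ℂ)]
      fun z ↦ (eulerFn 4 ∘ ofComplex) z * (eulerFn 10 ∘ ofComplex) z ^ 5
        / (Function.Periodic.qParam 1 z ^ 2 * (eulerFn 2 ∘ ofComplex) z
          * (eulerFn 20 ∘ ofComplex) z ^ 5) := by
    filter_upwards [isOpen_upperHalfPlaneSet.mem_nhds τ.im_pos] with z hz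
    simp only [Function.comp_apply, x20_eq, ofComplex_apply_of_im_pos hz]
  rw [hfun.deriv_eq]
  have h2 := hasDerivAt_eulerFn_comp 2 τ
  have h4 := hasDerivAt_eulerFn_comp 4 τ
  have h10 := hasDerivAt_eulerFn_comp 10 τ
  have h20 := hasDerivAt_eulerFn_comp 20 τ
  have hqd : HasDerivAt (Function.Periodic.qParam 1) (2 * π * I * Function.Periodic.qParam 1 (τ : ℂ)) τ := by
    simpa using hasDerivAt_qParam 1 (τ : ℂ)
  have hden : Function.Periodic.qParam 1 (τ : ℂ) ^ 2 * (eulerFn 2 ∘ ofComplex) τ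
      * (eulerFn 20 ∘ ofComplex) τ ^ 5 ≠ 0 := by
    simp only [Function.comp_apply, ofComplex_apply]
    exact mul_ne_zero (mul_ne_zero (pow_ne_zero _ hq) hE2) (pow_ne_zero _ hE20)
  have hD := (h4.fun_mul (h10.fun_pow 5)).fun_div
    (((hqd.fun_pow 2).fun_mul h2).fun_mul (h20.fun_pow 5)) hden
  rw [hD.deriv]
  simp only [Function.comp_apply, ofComplex_apply]
  field_simp
  ring

/-- **`y′ = y · (E₄′/E₄ + 5E₅′/E₅ − 3·2πi − E₁′/E₁ − 5E₂₀′/E₂₀)`.** [folklore] -/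
theorem deriv_y20 (τ : ℍ) :
    deriv (etaQuotient 20 (expFn [(1, -1), (4, 1), (5, 5), (20, -5)]) ∘ ofComplex) τ
      = eulerFn 4 τ * eulerFn 5 τ ^ 5
          / (Function.Periodic.qParam 1 (τ : ℂ) ^ 3 * eulerFn 1 τ * eulerFn 20 τ ^ 5)
        * (deriv (eulerFn 4 ∘ ofComplex) τ / eulerFn 4 τ
          + 5 * deriv (eulerFn 5 ∘ ofComplex) τ / eulerFn 5 τ - 3 * (2 * π * I)
          - deriv (eulerFn 1 ∘ ofComplex) τ / eulerFn 1 τ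
          - 5 * deriv (eulerFn 20 ∘ ofComplex) τ / eulerFn 20 τ) := by
  have hE1 := eulerFn_ne_zero (by norm_num : 0 < 1) τ
  have hE4 := eulerFn_ne_zero (by norm_num : 0 < 4) τ
  have hE5 := eulerFn_ne_zero (by norm_num : 0 < 5) τ
  have hE20 := eulerFn_ne_zero (by norm_num : 0 < 20) τ
  have hq := qParam_ne_zero τ
  have hfun : (etaQuotient 20 (expFn [(1, -1), (4, 1), (5, 5), (20, -5)]) ∘ ofComplex) =ᶠ[𝓝 (τ : ℂ)]
      fun z ↦ (eulerFn 4 ∘ ofComplex) z * (eulerFn 5 ∘ ofComplex) z ^ 5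
        / (Function.Periodic.qParam 1 z ^ 3 * (eulerFn 1 ∘ ofComplex) z
          * (eulerFn 20 ∘ ofComplex) z ^ 5) := by
    filter_upwards [isOpen_upperHalfPlaneSet.mem_nhds τ.im_pos] with z hz
    simp only [Function.comp_apply, y20_eq, ofComplex_apply_of_im_pos hz]
  rw [hfun.deriv_eq]
  have h1 := hasDerivAt_eulerFn_comp 1 τ
  have h4 := hasDerivAt_eulerFn_comp 4 τ
  have h5 := hasDerivAt_eulerFn_comp 5 τ
  have h20 := hasDerivAt_eulerFn_comp 20 τ
  have hqd : HasDerivAt (Function.Periodic.qParam 1) (2 * π * I * Function.Periodic.qParam 1 (τ : ℂ)) τ := by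
    simpa using hasDerivAt_qParam 1 (τ : ℂ)
  have hden : Function.Periodic.qParam 1 (τ : ℂ) ^ 3 * (eulerFn 1 ∘ ofComplex) τ
      * (eulerFn 20 ∘ ofComplex) τ ^ 5 ≠ 0 := by
    simp only [Function.comp_apply, ofComplex_apply]
    exact mul_ne_zero (mul_ne_zero (pow_ne_zero _ hq) hE1) (pow_ne_zero _ hE20)
  have hD := (h4.fun_mul (h5.fun_pow 5)).fun_div
    (((hqd.fun_pow 3).fun_mul h1).fun_mul (h20.fun_pow 5)) hden
  rw [hD.deriv]
  simp only [Function.comp_apply, ofComplex_apply]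
  field_simp
  ring

end Summit.BirchSwinnertonDyer.BirchSwinnertonDyer.Theorems.ManinLocalTwoThree.EulerRemaindersTwenty

end
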